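import Literature.Topology.FourManifolds.ToricBlowupPolar
import Literature.Geometry.Manifold.LocalDiffeoOnOpen
import HarnessLib

/-!
# The resolution-neck piece of the tube of `Σ̄₂` in plumbing coordinates

Topic `Literature/Topology/FourManifolds` (fact seat of the Seiberg–Witten leaf
`Literature.Barriers.SmoothPoincare4.akhmedovPark2010_lemma8_invariants`; block 2 of
Akhmedov–Park's `X₁(m)`, A. Akhmedov, B. D. Park, Invent. Math. 181 (2010), §3: "resolve the
intersection point `x₂ × y₀`" of `S₁ = T² × {y₀}` and `S₂ = T_β`).  The local model of the
resolution is the neck map `N : ℂ × ℂ → ℂ × ℂ` of `DoublePointResolutionNeck.lean`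
(`exists_resolutionNeck`); the plumbing chart `P` of the ambient `4`-manifold `X` at the double
point (`SurfaceTimesTorusPlumbingChart.lean`) identifies a neighbourhood with `ℂ × ℂ`
(`toC2`, `fromC2` of `ToricBlowupPolar.lean`), the first sheet's product tube `T` being LINEAR in
it: `toC2 (P (T (p, v))) = (A p, c v)` with `A = eF` (as a complex number) the surface chart.
This file assembles from these data — ALL TAKEN AS HYPOTHESES (the properties delivered by
`exists_resolutionNeck`, `exists_plumbingChart`), so that the file is independent of those
constructions — the **neck piece of the tube of the resolved surface over the first sheet**,

  `Nk (p, ṽ) = P⁻¹ (fromC2 (N (A p, k ṽ)))`,  `p ∈ Ω = eF.source ∖ A⁻¹ 0`, `‖ṽ‖ < δ/k`,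

and proves what the assembly of `Σ̄₂` (Kervaire–Milnor gluing of the two sheets' parameter tori
along `A` and the reflected second chart) consumes:

* `contMDiffOn_neckPiece` — smooth on `Ω × B(0, δ/k)`;
* `injOn_neckPiece` — injective there;
* `isOpen_image_neckPiece` — images of open subsets are open (inverse function theorem for `N`,
  `LocalDiffeoOnOpen.lean`);
* `exists_inverse_neckPiece` — a left inverse smooth on the image;
* `neckPiece_eq_tube_of_ge` — on the OUTER zone `‖A p‖ ≥ 3/4` the piece is the product tube with
  the fibre turned by `conj (A p/‖A p‖)`: `Nk (p, ṽ) = T (p, (k/c) conj û ṽ)`;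
* `toC2_neckPiece_of_le` — on the INNER zone `‖A p‖ ≤ 1/4` it is the second sheet's product tube
  at the Kervaire–Milnor partner point: `toC2 (P (Nk (p, ṽ))) = (û k ṽ, (1 - ‖A p‖) conj û)`;
* `neckPiece_mem` — it stays in `P⁻¹` of the unit bidisc (first coordinate `= A p` when
  `‖A p‖ ≥ 3/4`).

Everything is proved; no definitions (maps bound by hypotheses `hA`, `hNk`, …).

## References

* A. Akhmedov, B. D. Park, Invent. Math. 181 (2010) 577–603 = arXiv:math/0701829, §3. [AkhmedovPark2010]
* R. Kirby, *The Topology of 4-Manifolds*, LNM 1374 (1989), Ch. V. [Kirby1989]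
* J. M. Lee, *Introduction to Smooth Manifolds*, 2nd ed. (2013), Thm. 4.5, Prop. 5.2. [LeeSmoothManifolds2013]
-/

noncomputable section

open scoped Manifold ContDiff Topology ComplexConjugate
open Set Function Complex
open Literature.Topology.FourManifolds.ToricBlowup

namespace Literature.Topology.FourManifolds

namespace NeckPiece

/-! ### §0 `ℝ² ≅ ℂ` bookkeeping -/

section Coord

variable {cx : EuclideanSpace ℝ (Fin 2) → ℂ} {vc : ℂ → EuclideanSpace ℝ (Fin 2)}
  (hcx : ∀ v, cx v = ⟨v 0, v 1⟩)
  (hvc : ∀ z, vc z = z.re • EuclideanSpace.single 0 (1 : ℝ) + z.im • EuclideanSpace.single 1 (1 : ℝ))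

include hvc in
/-- Coordinates of `vc z`. [folklore] -/
theorem vc_apply (z : ℂ) : vc z 0 = z.re ∧ vc z 1 = z.im := by
  rw [hvc]; constructor <;> simp

include hcx hvc in
/-- `cx ∘ vc = id`. [folklore] -/
theorem cx_vc (z : ℂ) : cx (vc z) = z := by
  obtain ⟨h0, h1⟩ := vc_apply hvc z
  rw [hcx, h0, h1]

include hcx hvc in
/-- `vc ∘ cx = id`. [folklore] -/
theorem vc_cx (v : EuclideanSpace ℝ (Fin 2)) : vc (cx v) = v := by
  obtain ⟨h0, h1⟩ := vc_apply hvc (cx v)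
  ext i
  fin_cases i
  · simpa [hcx] using h0
  · simpa [hcx] using h1

include hcx in
/-- `cx` is norm preserving. [folklore] -/
theorem norm_cx (v : EuclideanSpace ℝ (Fin 2)) : ‖cx v‖ = ‖v‖ := by
  rw [hcx, EuclideanSpace.norm_eq, Complex.norm_def, Complex.normSq_apply]
  congr 1
  simp [Fin.sum_univ_two, sq]

include hcx in
/-- `cx` is injective. [folklore] -/
theorem cx_injective : Injective cx := fun v w h => by
  rw [hcx, hcx] at h
  have h0 := congrArg Complex.re h
  have h1 := congrArg Complex.im h
  simp only at h0 h1
  ext i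
  fin_cases i
  · exact h0
  · exact h1

include hcx in
/-- `cx` commutes with real scalings. [folklore] -/
theorem cx_smul (r : ℝ) (v : EuclideanSpace ℝ (Fin 2)) : cx (r • v) = (r : ℂ) * cx v := by
  rw [hcx, hcx]
  apply Complex.ext <;> simp

include hcx in
/-- `cx` is smooth (it is `ℝ`-linear). [folklore] -/
theorem contMDiff_cx : ContMDiff (𝓡 2) 𝓘(ℝ, ℂ) ∞ cx := by
  have h0 : ContMDiff (𝓡 2) 𝓘(ℝ, ℝ) ∞ (fun v : EuclideanSpace ℝ (Fin 2) => v 0) :=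
    (EuclideanSpace.proj (𝕜 := ℝ) (ι := Fin 2) 0).contMDiff
  have h1 : ContMDiff (𝓡 2) 𝓘(ℝ, ℝ) ∞ (fun v : EuclideanSpace ℝ (Fin 2) => v 1) :=
    (EuclideanSpace.proj (𝕜 := ℝ) (ι := Fin 2) 1).contMDiff
  have h : ContMDiff (𝓡 2) 𝓘(ℝ, ℂ) ∞ fun v : EuclideanSpace ℝ (Fin 2) =>
      Complex.equivRealProdCLM.symm (v 0, v 1) :=
    Complex.equivRealProdCLM.symm.contDiff.comp_contMDiff (h0.prodMk_space h1)
  have heq : cx = fun v : EuclideanSpace ℝ (Fin 2) => Complex.equivRealProdCLM.symm (v 0, v 1) := by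
    funext v; rw [hcx]; rfl
  rw [heq]; exact h

include hvc in
/-- `vc` is smooth. [folklore] -/
theorem contMDiff_vc : ContMDiff 𝓘(ℝ, ℂ) (𝓡 2) ∞ vc := by
  have : vc = fun z : ℂ => z.re • EuclideanSpace.single 0 (1 : ℝ) + z.im • EuclideanSpace.single 1 (1 : ℝ) :=
    funext hvc
  rw [this]
  exact (Complex.reCLM.contMDiff.smul contMDiff_const).add (Complex.imCLM.contMDiff.smul contMDiff_const)

end Coord

/-! ### §1 The data and the piece -/

section Piece

variable {F : Type} [TopologicalSpace F] [ChartedSpace (EuclideanSpace ℝ (Fin 2)) F]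
  {X : Type} [TopologicalSpace X] [ChartedSpace (EuclideanSpace ℝ (Fin 4)) X]
  {cx : EuclideanSpace ℝ (Fin 2) → ℂ} {vc : ℂ → EuclideanSpace ℝ (Fin 2)}
  {eF : OpenPartialHomeomorph F (EuclideanSpace ℝ (Fin 2))} {A : F → ℂ}
  {P : OpenPartialHomeomorph X (EuclideanSpace ℝ (Fin 4))}
  {T : F × EuclideanSpace ℝ (Fin 2) → X} {c : ℝ}
  {N : ℂ × ℂ → ℂ × ℂ} {δ k : ℝ}
  {Nk : F × EuclideanSpace ℝ (Fin 2) → X}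

variable (hcx : ∀ v, cx v = ⟨v 0, v 1⟩)
  (hvc : ∀ z, vc z = z.re • EuclideanSpace.single 0 (1 : ℝ) + z.im • EuclideanSpace.single 1 (1 : ℝ))
  (heF : eF ∈ IsManifold.maximalAtlas (𝓡 2) ∞ F) (heFt : eF.target = univ)
  (hA : ∀ p, A p = cx (eF p))
  (hP : P ∈ IsManifold.maximalAtlas (𝓡 4) ∞ X) (hPt : P.target = univ)
  (hc : 0 < c)
  (hPT : ∀ p, p ∈ eF.source → ∀ v : EuclideanSpace ℝ (Fin 2),
    T (p, v) ∈ P.source ∧ toC2 (P (T (p, v))) = (A p, (c : ℂ) * cx v))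
  (hδ : 0 < δ)
  (hN1 : ContDiffOn ℝ ∞ N {p : ℂ × ℂ | p.1 ≠ 0})
  (hN2 : ∀ v ρ : ℂ, 3 / 4 ≤ ‖v‖ → N (v, ρ) = (v, conj (((‖v‖⁻¹ : ℝ) : ℂ) * v) * ρ))
  (hN3 : ∀ v ρ : ℂ, ‖v‖ ≤ 1 / 4 → N (v, ρ) =
    ((((‖v‖⁻¹ : ℝ) : ℂ) * v) * ρ, conj (((‖v‖⁻¹ : ℝ) : ℂ) * v) * (((1 - ‖v‖ : ℝ)) : ℂ)))
  (hN4 : InjOn N {p : ℂ × ℂ | p.1 ≠ 0 ∧ ‖p.2‖ < δ})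
  (hN5 : ∀ p : ℂ × ℂ, p.1 ≠ 0 → ‖p.2‖ < δ →
    ∃ L : (ℂ × ℂ) ≃L[ℝ] (ℂ × ℂ), HasStrictFDerivAt N (L : ℂ × ℂ →L[ℝ] ℂ × ℂ) p)
  (hN6 : ∀ p : ℂ × ℂ, p.1 ≠ 0 → ‖p.2‖ < δ → ‖(N p).2‖ < 1 ∧ (‖p.1‖ < 1 → ‖(N p).1‖ < 1))
  (hk : 0 < k)
  (hNk : ∀ (p : F) (w : EuclideanSpace ℝ (Fin 2)),
    Nk (p, w) = P.symm (fromC2 (N (A p, (k : ℂ) * cx w))))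

omit [ChartedSpace (EuclideanSpace ℝ (Fin 4)) X] in
include hPt in
/-- `P (P⁻¹ y) = y` and `P⁻¹ y ∈ P.source` for every `y` (the target is all of `ℝ⁴`). [folklore] -/
theorem apply_symm (y : EuclideanSpace ℝ (Fin 4)) : P (P.symm y) = y ∧ P.symm y ∈ P.source := by
  have hy : y ∈ P.target := by rw [hPt]; exact mem_univ y
  exact ⟨P.right_inv hy, P.map_target hy⟩

include hcx hA heF in
/-- `A` is smooth on the chart domain. [folklore] -/
theorem contMDiffOn_A : ContMDiffOn (𝓡 2) 𝓘(ℝ, ℂ) ∞ A eF.source := by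
  have : A = cx ∘ eF := funext fun p => hA p
  rw [this]
  exact (contMDiff_cx hcx).comp_contMDiffOn (contMDiffOn_of_mem_maximalAtlas heF)

omit [ChartedSpace (EuclideanSpace ℝ (Fin 2)) F] in
include hcx hA in
/-- `A` is injective on the chart domain. [folklore] -/
theorem injOn_A : InjOn A eF.source := fun p hp q hq h => by
  rw [hA, hA] at h
  exact eF.injOn hp hq (cx_injective hcx h)

omit [ChartedSpace (EuclideanSpace ℝ (Fin 2)) F] in
include hcx hvc hA in
/-- `eF⁻¹ (vc (A p)) = p` on the chart domain. [folklore] -/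
theorem symm_vc_A {p : F} (hp : p ∈ eF.source) : eF.symm (vc (A p)) = p := by
  rw [hA, vc_cx hcx hvc, eF.left_inv hp]

include hcx hk in
/-- The fibre parameter `k ṽ` has norm `< δ` iff `‖ṽ‖ < δ/k`. [folklore] -/
theorem norm_fibre_lt {w : EuclideanSpace ℝ (Fin 2)} (hw : ‖w‖ < δ / k) : ‖(k : ℂ) * cx w‖ < δ := by
  rw [norm_mul, Complex.norm_real, Real.norm_of_nonneg hk.le, norm_cx hcx]
  rwa [lt_div_iff₀ hk, mul_comm] at hw

omit [TopologicalSpace F] [ChartedSpace (EuclideanSpace ℝ (Fin 2)) F]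
  [ChartedSpace (EuclideanSpace ℝ (Fin 4)) X] in
include hPt hNk in
/-- The defining identity in coordinates: `toC2 (P (Nk (p, ṽ))) = N (A p, k ṽ)`, and
`Nk (p, ṽ) ∈ P.source`. [folklore] -/
theorem toC2_neckPiece (p : F) (w : EuclideanSpace ℝ (Fin 2)) :
    toC2 (P (Nk (p, w))) = N (A p, (k : ℂ) * cx w) ∧ Nk (p, w) ∈ P.source := by
  obtain ⟨h1, h2⟩ := apply_symm hPt (fromC2 (N (A p, (k : ℂ) * cx w)))
  rw [hNk, h1, toC2_fromC2]
  exact ⟨rfl, h2⟩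

include hcx heF hA hP hPt hN1 hNk in
/-- **The neck piece is smooth** on `Ω × B(0, δ/k)`, `Ω = eF.source ∖ A⁻¹ 0` (indeed on
`Ω × ℝ²`). [cite: AkhmedovPark2010, §3] -/
theorem contMDiffOn_neckPiece :
    ContMDiffOn ((𝓡 2).prod (𝓡 2)) (𝓡 4) ∞ Nk ({p | p ∈ eF.source ∧ A p ≠ 0} ×ˢ univ) := by
  have hAsm := contMDiffOn_A hcx heF hA
  have hΛ : ContMDiffOn ((𝓡 2).prod (𝓡 2)) 𝓘(ℝ, ℂ × ℂ) ∞
      (fun q : F × EuclideanSpace ℝ (Fin 2) => (A q.1, (k : ℂ) * cx q.2))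
      ({p | p ∈ eF.source ∧ A p ≠ 0} ×ˢ univ) := by
    refine ContMDiffOn.prodMk_space ?_ ?_
    · exact hAsm.comp contMDiff_fst.contMDiffOn fun q hq => hq.1.1
    · have hmulk : ContDiff ℝ ∞ fun z : ℂ => (k : ℂ) * z := contDiff_const.mul contDiff_id
      exact (hmulk.comp_contMDiff ((contMDiff_cx hcx).comp contMDiff_snd)).contMDiffOn
  have hNΛ : ContMDiffOn ((𝓡 2).prod (𝓡 2)) 𝓘(ℝ, ℂ × ℂ) ∞
      (fun q : F × EuclideanSpace ℝ (Fin 2) => N (A q.1, (k : ℂ) * cx q.2))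
      ({p | p ∈ eF.source ∧ A p ≠ 0} ×ˢ univ) :=
    hN1.contMDiffOn.comp hΛ fun q hq => hq.1.2
  have hfrom : ContMDiff 𝓘(ℝ, ℂ × ℂ) (𝓡 4) ∞ fromC2 := contDiff_fromC2.contMDiff
  have hsymm : ContMDiffOn (𝓡 4) (𝓡 4) ∞ P.symm univ := by
    rw [← hPt]; exact contMDiffOn_symm_of_mem_maximalAtlas hP
  have heq : Nk = fun q : F × EuclideanSpace ℝ (Fin 2) =>
      P.symm (fromC2 (N (A q.1, (k : ℂ) * cx q.2))) := funext fun ⟨p, w⟩ => hNk p w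
  rw [heq]
  exact hsymm.comp (hfrom.comp_contMDiffOn hNΛ) fun _ _ => mem_univ _

omit [ChartedSpace (EuclideanSpace ℝ (Fin 2)) F] [ChartedSpace (EuclideanSpace ℝ (Fin 4)) X] in
include hcx hA hPt hN4 hk hNk in
/-- **The neck piece is injective** on `Ω × B(0, δ/k)`. [cite: AkhmedovPark2010, §3] -/
theorem injOn_neckPiece :
    InjOn Nk ({p | p ∈ eF.source ∧ A p ≠ 0} ×ˢ Metric.ball 0 (δ / k)) := by
  rintro ⟨p, w⟩ ⟨⟨hp, hp0⟩, hw⟩ ⟨p', w'⟩ ⟨⟨hp', hp0'⟩, hw'⟩ h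
  rw [Metric.mem_ball, dist_zero_right] at hw hw'
  have h1 := congrArg (fun x => toC2 (P x)) h
  rw [(toC2_neckPiece hPt hNk p w).1, (toC2_neckPiece hPt hNk p' w').1] at h1
  have h2 := hN4 ⟨hp0, norm_fibre_lt hcx hk hw⟩ ⟨hp0', norm_fibre_lt hcx hk hw'⟩ h1
  obtain ⟨hAA, hww⟩ := Prod.mk.inj h2
  have hpp : p = p' := injOn_A hcx hA hp hp' hAA
  have hww' : w = w' := by
    have : cx w = cx w' := mul_left_cancel₀ (Complex.ofReal_ne_zero.2 hk.ne') hww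
    exact cx_injective hcx this
  rw [hpp, hww']

omit [ChartedSpace (EuclideanSpace ℝ (Fin 2)) F] [ChartedSpace (EuclideanSpace ℝ (Fin 4)) X] in
include hcx hvc hA hPt hN5 hk hNk in
/-- **The neck piece is open**: images of open subsets of `Ω × B(0, δ/k)` are open (chart,
linear isomorphisms, and the inverse function theorem for `N`). [cite: LeeSmoothManifolds2013, Prop. 4.22] -/
theorem isOpen_image_neckPiece {W : Set (F × EuclideanSpace ℝ (Fin 2))} (hWo : IsOpen W)
    (hW : W ⊆ {p | p ∈ eF.source ∧ A p ≠ 0} ×ˢ Metric.ball 0 (δ / k)) : IsOpen (Nk '' W) := by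
  -- the factorisation `Nk = P.symm ∘ fromC2 ∘ N ∘ CC ∘ EK`
  let Hk : EuclideanSpace ℝ (Fin 2) ≃ₜ EuclideanSpace ℝ (Fin 2) := Homeomorph.smulOfNeZero k hk.ne'
  let EK : OpenPartialHomeomorph (F × EuclideanSpace ℝ (Fin 2))
      (EuclideanSpace ℝ (Fin 2) × EuclideanSpace ℝ (Fin 2)) := eF.prod Hk.toOpenPartialHomeomorph
  let CC : (EuclideanSpace ℝ (Fin 2) × EuclideanSpace ℝ (Fin 2)) ≃ₜ ℂ × ℂ :=
    { toFun := fun q => (cx q.1, cx q.2)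
      invFun := fun q => (vc q.1, vc q.2)
      left_inv := fun q => by simp [vc_cx hcx hvc]
      right_inv := fun q => by simp [cx_vc hcx hvc]
      continuous_toFun := ((contMDiff_cx hcx).continuous.comp continuous_fst).prodMk
        ((contMDiff_cx hcx).continuous.comp continuous_snd)
      continuous_invFun := ((contMDiff_vc hvc).continuous.comp continuous_fst).prodMk
        ((contMDiff_vc hvc).continuous.comp continuous_snd) }
  let FC : ℂ × ℂ ≃ₜ EuclideanSpace ℝ (Fin 4) :=
    { toFun := fromC2
      invFun := toC2
      left_inv := toC2_fromC2
      right_inv := fromC2_toC2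
      continuous_toFun := contDiff_fromC2.continuous
      continuous_invFun := contDiff_toC2.continuous }
  have hfac : ∀ q : F × EuclideanSpace ℝ (Fin 2), Nk q = P.symm (FC (N (CC (EK q)))) := by
    rintro ⟨p, w⟩
    rw [hNk]
    show P.symm (fromC2 (N (A p, (k : ℂ) * cx w))) = P.symm (fromC2 (N (cx (eF p), cx (k • w))))
    rw [hA, cx_smul hcx]
  have himage : Nk '' W = P.symm '' (FC '' (N '' (CC '' (EK '' W)))) := by
    ext x
    simp only [mem_image]
    constructor
    · rintro ⟨q, hq, rfl⟩
      exact ⟨_, ⟨_, ⟨_, ⟨_, ⟨q, hq, rfl⟩, rfl⟩, rfl⟩, rfl⟩, (hfac q).symm⟩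
    · rintro ⟨_, ⟨_, ⟨_, ⟨_, ⟨q, hq, rfl⟩, rfl⟩, rfl⟩, rfl⟩, rfl⟩
      exact ⟨q, hq, hfac q⟩
  rw [himage]
  -- each factor is open on the relevant set
  have hWs : W ⊆ EK.source := by
    intro q hq
    show q ∈ eF.source ×ˢ (univ : Set (EuclideanSpace ℝ (Fin 2)))
    exact ⟨(hW hq).1.1, mem_univ _⟩
  have h1 : IsOpen (EK '' W) := EK.isOpen_image_of_subset_source hWo hWs
  have h2 : IsOpen (CC '' (EK '' W)) := CC.isOpenMap _ h1
  have h3 : IsOpen (N '' (CC '' (EK '' W))) := by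
    refine Literature.Geometry.Manifold.isOpen_image_of_subset_of_forall_hasStrictFDerivAt_equiv
      (U := {p : ℂ × ℂ | p.1 ≠ 0 ∧ ‖p.2‖ < δ}) (fun p hp => hN5 p hp.1 hp.2) h2 ?_
    rintro _ ⟨_, ⟨⟨p, w⟩, hq, rfl⟩, rfl⟩
    obtain ⟨⟨hp, hp0⟩, hw⟩ := hW hq
    rw [Metric.mem_ball, dist_zero_right] at hw
    show cx (eF p) ≠ 0 ∧ ‖cx (k • w)‖ < δ
    refine ⟨by rwa [← hA], ?_⟩
    rw [norm_cx hcx, norm_smul, Real.norm_of_nonneg hk.le]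
    rwa [lt_div_iff₀ hk, mul_comm] at hw
  have h4 : IsOpen (FC '' (N '' (CC '' (EK '' W)))) := FC.isOpenMap _ h3
  refine P.symm.isOpen_image_of_subset_source h4 ?_
  intro y _
  show y ∈ P.target
  rw [hPt]; exact mem_univ y

include hcx hvc heF heFt hA hP hPt hN1 hN4 hN5 hk hNk in
/-- **A left inverse of the neck piece, smooth on its image** (the inverse of `N` on the image of
`{v ≠ 0} × B(0, δ)` is smooth by the inverse function theorem,
`contDiffOn_invFunOn_of_forall_hasStrictFDerivAt_equiv`). [cite: LeeSmoothManifolds2013, Thm. 4.5] -/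
theorem exists_inverse_neckPiece :
    ∃ Ninv : X → F × EuclideanSpace ℝ (Fin 2),
      ContMDiffOn (𝓡 4) ((𝓡 2).prod (𝓡 2)) ∞ Ninv
        (Nk '' ({p | p ∈ eF.source ∧ A p ≠ 0} ×ˢ Metric.ball 0 (δ / k))) ∧
      ∀ q ∈ {p | p ∈ eF.source ∧ A p ≠ 0} ×ˢ Metric.ball (0 : EuclideanSpace ℝ (Fin 2)) (δ / k),
        Ninv (Nk q) = q := by
  set U : Set (ℂ × ℂ) := {p : ℂ × ℂ | p.1 ≠ 0 ∧ ‖p.2‖ < δ} with hU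
  have hUo : IsOpen U :=
    (isOpen_ne_fun continuous_fst continuous_const).inter
      (isOpen_lt (continuous_norm.comp continuous_snd) continuous_const)
  let invN : ℂ × ℂ → ℂ × ℂ := invFunOn N U
  have hinvN : ContDiffOn ℝ ∞ invN (N '' U) :=
    Literature.Geometry.Manifold.contDiffOn_invFunOn_of_forall_hasStrictFDerivAt_equiv hUo
      (hN1.mono fun p hp => hp.1) (by simp) hN4 fun p hp => hN5 p hp.1 hp.2
  have hleftN : ∀ q ∈ U, invN (N q) = q := fun q hq => hN4.leftInvOn_invFunOn hq
  let Ninv : X → F × EuclideanSpace ℝ (Fin 2) := fun x =>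
    (eF.symm (vc (invN (toC2 (P x))).1), k⁻¹ • vc (invN (toC2 (P x))).2)
  set D : Set (F × EuclideanSpace ℝ (Fin 2)) :=
    {p | p ∈ eF.source ∧ A p ≠ 0} ×ˢ Metric.ball (0 : EuclideanSpace ℝ (Fin 2)) (δ / k) with hD
  have hΛU : ∀ q ∈ D, (A q.1, (k : ℂ) * cx q.2) ∈ U := by
    rintro ⟨p, w⟩ ⟨⟨hp, hp0⟩, hw⟩
    rw [Metric.mem_ball, dist_zero_right] at hw
    exact ⟨hp0, norm_fibre_lt hcx hk hw⟩
  refine ⟨Ninv, ?_, ?_⟩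
  · -- smoothness on the image
    have hPsm : ContMDiffOn (𝓡 4) (𝓡 4) ∞ P P.source := contMDiffOn_of_mem_maximalAtlas hP
    have himg : ∀ x ∈ Nk '' D, x ∈ P.source ∧ toC2 (P x) ∈ N '' U := by
      rintro _ ⟨q, hq, rfl⟩
      obtain ⟨p, w⟩ := q
      obtain ⟨h1, h2⟩ := toC2_neckPiece hPt hNk p w
      exact ⟨h2, by rw [h1]; exact ⟨_, hΛU _ hq, rfl⟩⟩
    have hG : ContMDiffOn (𝓡 4) 𝓘(ℝ, ℂ × ℂ) ∞ (fun x => invN (toC2 (P x))) (Nk '' D) := by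
      refine hinvN.contMDiffOn.comp ((contDiff_toC2.contMDiff.comp_contMDiffOn
        (hPsm.mono fun x hx => (himg x hx).1))) fun x hx => (himg x hx).2
    have hsymm : ContMDiffOn (𝓡 2) (𝓡 2) ∞ eF.symm univ := by
      rw [← heFt]; exact contMDiffOn_symm_of_mem_maximalAtlas heF
    have hG1 : ContMDiffOn (𝓡 4) 𝓘(ℝ, ℂ) ∞ (fun x => (invN (toC2 (P x))).1) (Nk '' D) :=
      fun x hx => contDiff_fst.contDiffAt.comp_contMDiffWithinAt (hG x hx)
    have hG2 : ContMDiffOn (𝓡 4) 𝓘(ℝ, ℂ) ∞ (fun x => (invN (toC2 (P x))).2) (Nk '' D) :=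
      fun x hx => contDiff_snd.contDiffAt.comp_contMDiffWithinAt (hG x hx)
    have hG2' : ContMDiffOn (𝓡 4) (𝓡 2) ∞ (fun x => vc (invN (toC2 (P x))).2) (Nk '' D) :=
      (contMDiff_vc hvc).comp_contMDiffOn hG2
    refine ContMDiffOn.prodMk ?_ ?_
    · exact hsymm.comp ((contMDiff_vc hvc).comp_contMDiffOn hG1) fun _ _ => mem_univ _
    · have hconst : ContMDiffOn (𝓡 4) 𝓘(ℝ, ℝ) ∞ (fun _ : X => (k⁻¹ : ℝ)) (Nk '' D) :=
        contMDiffOn_const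
      exact hconst.smul hG2'
  · -- left inverse
    rintro ⟨p, w⟩ hq
    obtain ⟨⟨hp, hp0⟩, hw⟩ := hq
    obtain ⟨h1, -⟩ := toC2_neckPiece hPt hNk p w
    show (eF.symm (vc (invN (toC2 (P (Nk (p, w))))).1),
      k⁻¹ • vc (invN (toC2 (P (Nk (p, w))))).2) = (p, w)
    rw [h1, hleftN _ (hΛU _ ⟨⟨hp, hp0⟩, hw⟩)]
    simp only
    rw [symm_vc_A hcx hvc hA hp]
    congr 1
    have : vc ((k : ℂ) * cx w) = k • w := by
      rw [← cx_smul hcx, vc_cx hcx hvc]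
    rw [this, smul_smul, inv_mul_cancel₀ hk.ne', one_smul]

omit [ChartedSpace (EuclideanSpace ℝ (Fin 2)) F] [ChartedSpace (EuclideanSpace ℝ (Fin 4)) X] in
include hcx hvc hPT hc hN2 hNk in
/-- **Outer zone: the neck piece is the first sheet's product tube with the fibre turned by
`conj û`**, `û = A p/‖A p‖`: for `‖A p‖ ≥ 3/4`,
`Nk (p, ṽ) = T (p, vc ((k/c) conj û · cx ṽ))`. [cite: AkhmedovPark2010, §3] -/
theorem neckPiece_eq_tube_of_ge {p : F} (hp : p ∈ eF.source) (hAp : 3 / 4 ≤ ‖A p‖)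
    (w : EuclideanSpace ℝ (Fin 2)) :
    Nk (p, w) = T (p, vc ((((k / c : ℝ)) : ℂ) * conj (((‖A p‖⁻¹ : ℝ) : ℂ) * A p) * cx w)) := by
  obtain ⟨hTmem, hTco⟩ := hPT p hp (vc ((((k / c : ℝ)) : ℂ) * conj (((‖A p‖⁻¹ : ℝ) : ℂ) * A p) * cx w))
  rw [cx_vc hcx hvc] at hTco
  have hc0 : (c : ℂ) ≠ 0 := Complex.ofReal_ne_zero.2 hc.ne'
  have hval : toC2 (P (T (p, vc ((((k / c : ℝ)) : ℂ) * conj (((‖A p‖⁻¹ : ℝ) : ℂ) * A p) * cx w)))) =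
      N (A p, (k : ℂ) * cx w) := by
    rw [hTco, hN2 _ _ hAp]
    congr 1
    push_cast
    field_simp
  calc Nk (p, w) = P.symm (fromC2 (N (A p, (k : ℂ) * cx w))) := hNk p w
    _ = P.symm (fromC2 (toC2 (P (T (p, vc ((((k / c : ℝ)) : ℂ) *
          conj (((‖A p‖⁻¹ : ℝ) : ℂ) * A p) * cx w)))))) := by rw [hval]
    _ = T (p, vc ((((k / c : ℝ)) : ℂ) * conj (((‖A p‖⁻¹ : ℝ) : ℂ) * A p) * cx w)) := by
          rw [fromC2_toC2, P.left_inv hTmem]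

omit [TopologicalSpace F] [ChartedSpace (EuclideanSpace ℝ (Fin 2)) F]
  [ChartedSpace (EuclideanSpace ℝ (Fin 4)) X] in
include hPt hN3 hNk in
/-- **Inner zone: the neck piece is the second sheet's product tube at the Kervaire–Milnor partner
point**: for `0 < ‖A p‖ ≤ 1/4`, `toC2 (P (Nk (p, ṽ))) = (û · k ṽ, (1 - ‖A p‖) conj û)`.
[cite: AkhmedovPark2010, §3] [cite: KervaireMilnor1963, §2] -/
theorem toC2_neckPiece_of_le {p : F} (hAp : ‖A p‖ ≤ 1 / 4) (w : EuclideanSpace ℝ (Fin 2)) :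
    toC2 (P (Nk (p, w))) = ((((‖A p‖⁻¹ : ℝ) : ℂ) * A p) * ((k : ℂ) * cx w),
      conj (((‖A p‖⁻¹ : ℝ) : ℂ) * A p) * (((1 - ‖A p‖ : ℝ)) : ℂ)) := by
  rw [(toC2_neckPiece hPt hNk p w).1, hN3 _ _ hAp]

omit [TopologicalSpace F] [ChartedSpace (EuclideanSpace ℝ (Fin 2)) F]
  [ChartedSpace (EuclideanSpace ℝ (Fin 4)) X] in
include hcx hPt hN2 hN6 hk hNk in
/-- **The neck piece stays in the unit bidisc of the plumbing chart**: for `(p, ṽ) ∈ Ω × B(0, δ/k)`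
the second plumbing coordinate has norm `< 1`, the first has norm `< 1` when `‖A p‖ < 1` and
equals `A p` when `‖A p‖ ≥ 3/4`. [cite: AkhmedovPark2010, §3] -/
theorem neckPiece_mem {p : F} (hp0 : A p ≠ 0) {w : EuclideanSpace ℝ (Fin 2)} (hw : ‖w‖ < δ / k) :
    Nk (p, w) ∈ P.source ∧ ‖(toC2 (P (Nk (p, w)))).2‖ < 1 ∧
      (‖A p‖ < 1 → ‖(toC2 (P (Nk (p, w)))).1‖ < 1) ∧
      (3 / 4 ≤ ‖A p‖ → (toC2 (P (Nk (p, w)))).1 = A p) := by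
  obtain ⟨h1, h2⟩ := toC2_neckPiece hPt hNk p w
  have hρ := norm_fibre_lt hcx hk hw
  obtain ⟨h3, h4⟩ := hN6 (A p, (k : ℂ) * cx w) hp0 hρ
  refine ⟨h2, by rw [h1]; exact h3, fun h => by rw [h1]; exact h4 h, fun h => ?_⟩
  rw [h1, hN2 _ _ h]

end Piece

end NeckPiece

end Literature.Topology.FourManifolds
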